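import Literature.NumberTheory.EllipticCurves.CuspFormTwistFrickeProofs
import Literature.NumberTheory.EllipticCurves.HeckeOperatorsProofs
import Literature.NumberTheory.EllipticCurves.CuspFormLFunctionFrickeProofs
import Literature.NumberTheory.EllipticCurves.NewformsHeckeProofs
import Literature.NumberTheory.EllipticCurves.ModularJacobianModPMultiplicityOne
import HarnessLib

/-!
# Hecke operators on quadratic twists of `Γ₀(N)` cusp forms: `T_p (f ⊗ χ) = χ(p) · (T_p f) ⊗ χ`

For a cusp form `f = ∑ aₙ qⁿ ∈ S_k(Γ₀(N))`, a primitive quadratic Dirichlet character `χ` modulo `m`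
and a level `L` with `N ∣ L`, `m² ∣ L`, the tree's twist `f ⊗ χ := charTwist L hN hm hχ f ∈ S_k(Γ₀(L))`
has `q`-expansion `∑ χ(n) aₙ qⁿ` (`cuspCoeff_charTwist`, Shimura 1971, Prop. 3.64). This file records how
the Hecke operators `T_p` (the tree's `heckeT`, which IS `U_p` at primes dividing the level) act on it:

* `heckeT_charTwist`: for a prime `p ∤ m` (so `χ(p) = ±1`) with `p ∣ N ↔ p ∣ L` (the same kind of
  operator, `T_p` or `U_p`, on both levels), `T_p (f ⊗ χ) = χ(p) · (T_p f) ⊗ χ`. Proof: compare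
  `q`-expansions — `aₙ(T_p h) = a_{pn}(h) + 𝟙_{p ∤ level} p^{k−1} a_{n/p}(h)` (Diamond–Shurman
  Prop. 5.2.2(a), the tree's discharged fact `qExpansion_coeff_heckeT_holds`) on both sides, with
  `χ(pn) = χ(p)χ(n)` and `χ(n/p) = χ(p)χ(n)` (`χ(p)² = 1`). This is the `Γ₀`, quadratic-character
  companion of the tree's `Γ₁` statement `heckeT_twistRaw1` (`CuspFormTwistGamma1`, `p ∤ L` there).
* `heckeT_charTwist_of_eq_smul`: a `T_p`-eigenform twists to a `T_p`-eigenform with eigenvalue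
  multiplied by `χ(p)` (Atkin–Li 1978, §3: "if `F` is an eigenform for `T_p`, `p ∤ M`, with eigenvalue
  `a_p`, then `F_χ` is one with eigenvalue `χ(p) a_p`"), also in the `HeckeRing0.toEnd (T p)` spelling
  used by Hecke-module consumers (`toEnd_T_charTwist_of_eq_smul`), and for newforms
  (`IsNewform0.heckeT_charTwist`, `IsNewformOf.heckeT_charTwist`: `T_p (f ⊗ χ) = χ(p) a_p (f ⊗ χ)`).
* `heckeT_charTwist_of_dvd`: for a prime `p ∣ m` (hence `p ∣ L`), `U_p (f ⊗ χ) = 0` — the twist is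
  `p`-depleted (`a_{pn}(f ⊗ χ) = χ(pn) a_{pn} = 0`).

Everything is proved; there are no named facts. Typical use (bsd-stepL, LINE 28 / the `PS_of` step):
`N = L`, `9 ∣ N`, `χ = χ₋₃` (`m = 3`), `f` the newform of an elliptic curve, giving the eigen-system
`T_p (f ⊗ χ₋₃) = χ₋₃(p) a_p(E) · (f ⊗ χ₋₃)` for `p ≠ 3` and `U₃ (f ⊗ χ₋₃) = 0`.

## References

* F. Diamond, J. Shurman, *A First Course in Modular Forms*, GTM 228, Springer 2005, Prop. 5.2.2(a),
  Prop. 5.3.1 (the `q`-expansion of `T_p`), Prop. 5.8.5 (`T_p f = a_p f` for newforms).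
* G. Shimura, *Introduction to the arithmetic theory of automorphic functions*, Princeton UP 1971,
  Prop. 3.64 (the twist `f_χ` and its `q`-expansion).
* A. O. L. Atkin, W.-C. W. Li, *Twists of newforms and pseudo-eigenvalues of `W`-operators*,
  Invent. Math. 48 (1978), 221–243, §3 (twists of `T_p`-eigenforms).
-/

noncomputable section

open scoped MatrixGroups ModularForm

open CongruenceSubgroup

namespace Literature.NumberTheory.EllipticCurves.ModularForms

section HeckeTwist

variable {N : ℕ} [NeZero N] {k : ℤ} {m : ℕ} [NeZero m] (L : ℕ) [NeZero L]

omit [NeZero N] in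
/-- `aₙ(T_p g) = a_{pn}(g) + 𝟙_{p ∤ M} · p^{k−1} · 𝟙_{p ∣ n} · a_{n/p}(g)` for `g ∈ S_k(Γ₀(M))` — the tree's
discharged fact `qExpansion_coeff_heckeT_holds` in the `cuspCoeff` spelling.
[cite: DiamondShurman2005, Prop. 5.2.2(a) and Prop. 5.3.1] -/
private theorem cuspCoeff_heckeT_eq {M : ℕ} [NeZero M] (g : CuspForm (Gamma0 M) k) {p : ℕ} [NeZero p]
    (hp : p.Prime) (n : ℕ) :
    cuspCoeff (heckeT (Gamma0 M) k p g) n =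
      cuspCoeff g (p * n) +
        (if p ∣ M then 0 else (p : ℂ) ^ (k - 1) * (if p ∣ n then cuspCoeff g (n / p) else 0)) :=
  qExpansion_coeff_heckeT_holds M k g p hp n

/-- **`T_p (f ⊗ χ) = χ(p) · (T_p f) ⊗ χ`** for a primitive quadratic character `χ` mod `m`, a prime
`p ∤ m`, and levels `N ∣ L`, `m² ∣ L` with `p ∣ N ↔ p ∣ L` (so that `heckeT … p` is the same kind of
operator — `T_p` if `p ∤ L`, `U_p` if `p ∣ N` — on both sides). On `q`-expansions both sides are
`χ(p)χ(n) a_{pn}(f) + 𝟙_{p ∤ L} p^{k−1} χ(p)χ(n) a_{n/p}(f)`, using `aₙ(f ⊗ χ) = χ(n) aₙ(f)`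
(`cuspCoeff_charTwist`), `χ(pn) = χ(p)χ(n)` and `χ(n/p) = χ(p)² χ(n/p) = χ(p) χ(n)` for `p ∣ n`.
[cite: DiamondShurman2005, Prop. 5.2.2(a) (q-expansion of T_p and U_p; derived reading: the identity follows coefficientwise from it and aₙ(f ⊗ χ) = χ(n) aₙ(f), Shimura 1971 Prop. 3.64 — derivation in this docstring; the eigenform case is Atkin–Li 1978 §3)] -/
theorem heckeT_charTwist (hN : N ∣ L) (hm : m ^ 2 ∣ L) {χ : DirichletCharacter ℂ m}
    (hχ : χ.IsQuadratic) (hprim : χ.IsPrimitive) (f : CuspForm (Gamma0 N) k) {p : ℕ} [NeZero p]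
    (hp : p.Prime) (hpm : ¬ p ∣ m) (hpNL : p ∣ N ↔ p ∣ L) :
    heckeT (Gamma0 L) k p (charTwist L hN hm hχ f) =
      χ (p : ZMod m) • charTwist L hN hm hχ (heckeT (Gamma0 N) k p f) := by
  have hsq : χ (p : ZMod m) * χ (p : ZMod m) = 1 := by
    rw [← sq]
    exact apply_sq_eq_one_of_isQuadratic hχ ((ZMod.isUnit_prime_iff_not_dvd hp).2 hpm)
  refine eq_of_forall_cuspCoeff_eq_gamma0 fun n ↦ ?_
  rw [cuspCoeff_smul, cuspCoeff_charTwist L hN hm hχ hprim (heckeT (Gamma0 N) k p f) n,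
    cuspCoeff_heckeT_eq (charTwist L hN hm hχ f) hp n, cuspCoeff_heckeT_eq f hp n,
    cuspCoeff_charTwist L hN hm hχ hprim f (p * n)]
  by_cases hpn : p ∣ n
  · obtain ⟨n', rfl⟩ := hpn
    rw [if_pos (dvd_mul_right p n'), if_pos (dvd_mul_right p n'), Nat.mul_div_cancel_left n' hp.pos,
      cuspCoeff_charTwist L hN hm hχ hprim f n']
    by_cases hpL : p ∣ L
    · rw [if_pos hpL, if_pos (hpNL.2 hpL)]
      push_cast
      simp only [map_mul]
      ring
    · rw [if_neg hpL, if_neg (fun h ↦ hpL (hpNL.1 h))]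
      push_cast
      simp only [map_mul]
      linear_combination (-((p : ℂ) ^ (k - 1) * χ (n' : ZMod m) * cuspCoeff f n')) * hsq
  · rw [if_neg hpn, if_neg hpn, mul_zero, ite_self, ite_self]
    push_cast
    simp only [map_mul]
    ring

/-- **The twist of a `T_p`-eigenform is a `T_p`-eigenform with eigenvalue multiplied by `χ(p)`**:
`T_p f = a f` gives `T_p (f ⊗ χ) = χ(p) a · (f ⊗ χ)` (`p ∤ m`, `p ∣ N ↔ p ∣ L`). Atkin–Li 1978, §3
(for `p` prime to the levels); the `U_p` case (`p ∣ N`) is the same `q`-expansion computation.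
[cite: DiamondShurman2005, Prop. 5.2.2(a) (derived reading via `heckeT_charTwist`; eigenform statement: Atkin–Li 1978, §3)] -/
theorem heckeT_charTwist_of_eq_smul (hN : N ∣ L) (hm : m ^ 2 ∣ L) {χ : DirichletCharacter ℂ m}
    (hχ : χ.IsQuadratic) (hprim : χ.IsPrimitive) {f : CuspForm (Gamma0 N) k} {p : ℕ} [NeZero p]
    (hp : p.Prime) (hpm : ¬ p ∣ m) (hpNL : p ∣ N ↔ p ∣ L) {a : ℂ} (hT : heckeT (Gamma0 N) k p f = a • f) :
    heckeT (Gamma0 L) k p (charTwist L hN hm hχ f) = (χ (p : ZMod m) * a) • charTwist L hN hm hχ f := by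
  rw [heckeT_charTwist L hN hm hχ hprim f hp hpm hpNL, hT, charTwist_smul L hN hm hχ a f, smul_smul]

/-- The same in the Hecke-ring spelling used by Hecke-module consumers (`HeckeRing0.toEnd (T p)` is
`heckeT`, `HeckeRing0.toEnd_T`): `T_p f = a f` on `S_k(Γ₀(N))` gives `T_p (f ⊗ χ) = χ(p) a · (f ⊗ χ)` on
`S_k(Γ₀(L))`. [cite: DiamondShurman2005, Prop. 5.2.2(a) (derived reading via `heckeT_charTwist`; eigenform statement: Atkin–Li 1978, §3)] -/
theorem toEnd_T_charTwist_of_eq_smul (hN : N ∣ L) (hm : m ^ 2 ∣ L) {χ : DirichletCharacter ℂ m}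
    (hχ : χ.IsQuadratic) (hprim : χ.IsPrimitive) {f : CuspForm (Gamma0 N) k} {p : ℕ} (hp : p.Prime)
    (hpm : ¬ p ∣ m) (hpNL : p ∣ N ↔ p ∣ L) {a : ℂ}
    (hT : HeckeRing0.toEnd N k (HeckeRing0.T N k p hp) f = a • f) :
    HeckeRing0.toEnd L k (HeckeRing0.T L k p hp) (charTwist L hN hm hχ f) =
      (χ (p : ZMod m) * a) • charTwist L hN hm hχ f := by
  haveI : NeZero p := ⟨hp.ne_zero⟩
  rw [HeckeRing0.toEnd_T] at hT ⊢
  exact heckeT_charTwist_of_eq_smul L hN hm hχ hprim hp hpm hpNL hT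

/-- **`T_p (f ⊗ χ) = χ(p) a_p(f) · (f ⊗ χ)` for a newform `f ∈ S_k(Γ₀(N))`** (`p ∤ m` prime,
`p ∣ N ↔ p ∣ L`): `T_p f = a_p(f) f` (Diamond–Shurman Prop. 5.8.5, the tree's
`IsNewform0.heckeT_eq_coeff_smul`) and `heckeT_charTwist_of_eq_smul`. [cite: DiamondShurman2005, Prop. 5.8.5 (with Prop. 5.2.2(a); twist: Atkin–Li 1978, §3)] -/
theorem IsNewform0.heckeT_charTwist (hN : N ∣ L) (hm : m ^ 2 ∣ L) {χ : DirichletCharacter ℂ m}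
    (hχ : χ.IsQuadratic) (hprim : χ.IsPrimitive) {f : CuspForm (Gamma0 N) k} (hf : IsNewform0 f)
    {p : ℕ} [NeZero p] (hp : p.Prime) (hpm : ¬ p ∣ m) (hpNL : p ∣ N ↔ p ∣ L) :
    heckeT (Gamma0 L) k p (charTwist L hN hm hχ f) =
      (χ (p : ZMod m) * cuspCoeff f p) • charTwist L hN hm hχ f :=
  heckeT_charTwist_of_eq_smul L hN hm hχ hprim hp hpm hpNL (hf.heckeT_eq_coeff_smul hp)

/-- **`T_p (f ⊗ χ) = χ(p) a_p(W) · (f ⊗ χ)` for the newform `f` of an elliptic curve `W/ℚ`**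
(`IsNewformOf W f`: `f` is a newform with `aₙ(f) = aₙ(W)`), `p ∤ m` prime, `p ∣ N ↔ p ∣ L`: the
modular form `f ⊗ χ` carries the eigen-system `χ(p) a_p(W)` of the quadratic twist `W^χ` at the primes
`p ∤ m`. [cite: DiamondShurman2005, Prop. 5.8.5 (with Prop. 5.2.2(a); twist: Atkin–Li 1978, §3)] -/
theorem IsNewformOf.heckeT_charTwist (hN : N ∣ L) (hm : m ^ 2 ∣ L) {χ : DirichletCharacter ℂ m}
    (hχ : χ.IsQuadratic) (hprim : χ.IsPrimitive) {W : WeierstrassCurve ℚ} {f : CuspForm (Gamma0 N) 2}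
    (hf : IsNewformOf W f) {p : ℕ} [NeZero p] (hp : p.Prime) (hpm : ¬ p ∣ m) (hpNL : p ∣ N ↔ p ∣ L) :
    heckeT (Gamma0 L) 2 p (charTwist L hN hm hχ f) =
      (χ (p : ZMod m) * (W.LFunction p : ℂ)) • charTwist L hN hm hχ f := by
  rw [← hf.2 p]
  exact hf.1.heckeT_charTwist L hN hm hχ hprim hp hpm hpNL

/-- **`U_p (f ⊗ χ) = 0` for a prime `p ∣ m`** (then `p ∣ m² ∣ L`, so `heckeT (Gamma0 L) k p` is `U_p`):
the twist is `p`-depleted, `aₙ(U_p(f ⊗ χ)) = a_{pn}(f ⊗ χ) = χ(pn) a_{pn}(f) = 0`.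
[cite: DiamondShurman2005, Prop. 5.2.2(a) (q-expansion of U_p; derived reading with aₙ(f ⊗ χ) = χ(n) aₙ(f), Shimura 1971 Prop. 3.64: χ(pn) = 0 for p ∣ m)] -/
theorem heckeT_charTwist_of_dvd (hN : N ∣ L) (hm : m ^ 2 ∣ L) {χ : DirichletCharacter ℂ m}
    (hχ : χ.IsQuadratic) (hprim : χ.IsPrimitive) (f : CuspForm (Gamma0 N) k) {p : ℕ} [NeZero p]
    (hp : p.Prime) (hpm : p ∣ m) :
    heckeT (Gamma0 L) k p (charTwist L hN hm hχ f) = 0 := by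
  have hpL : p ∣ L := hpm.trans ((dvd_pow_self m two_ne_zero).trans hm)
  have hχp : χ (p : ZMod m) = 0 := by
    rw [MulChar.map_nonunit]
    rw [ZMod.isUnit_prime_iff_not_dvd hp]
    exact fun h ↦ h hpm
  refine eq_of_forall_cuspCoeff_eq_gamma0 fun n ↦ ?_
  rw [cuspCoeff_heckeT_eq (charTwist L hN hm hχ f) hp n, if_pos hpL, add_zero,
    cuspCoeff_charTwist L hN hm hχ hprim f (p * n),
    cuspCoeff_zero_form (strictWidthInfty_Gamma0 L ▸ Subgroup.strictWidthInfty_mem_strictPeriods _)]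
  push_cast
  rw [map_mul, hχp, zero_mul, zero_mul]

end HeckeTwist

end Literature.NumberTheory.EllipticCurves.ModularForms

end
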